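import Summits.HodgeConjecture.HodgeConjecture.Theorems.Ring2HypothesesWeilComponentsSplit
import Summits.HodgeConjecture.HodgeConjecture.Theorems.Ring2WeilCoverageNormCriteria
import HarnessLib

/-!
# Ring 2 · Weil-type family-coverage census (ring2-b04, gen 40) — the SPLIT-SPECIAL-FIBRE RULE at cell level

research route conditional on HC_CM; not a corollary; Q11.4-sentence-2 already refuted in dim ≥ 3.
`HC_CM` (`Theses.RankFourFaces.CMAbelianHodge`, by name) does not occur in this file; no case of the Hodge
conjecture is claimed. Cell `pub-hodge-ring2`, seat `ring2-b04` (gen 40), `WEIL-FAMILY-COVERAGE.md` §b04.0.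

The census column «split special fibre? (yes — which split member / no — why)» asks, for a component
`(n, K = ℚ(√-d), δ)` of the Weil-type locus (the cell of `Ring2.Hypotheses.WeilClassesComponent n d δ`: abelian
`2n`-folds `(A, φ)`, `φ² = -d`, with a `K`-symmetrised hyperplane class `h_K = d·e^*a + φ^*e^*a` of non-degenerate
discriminant `det H = δ`), whether it contains a member that is HYPERBOLIC for `h_K`
(`Motives.IsHyperbolicWeilType`: Witt index `n`; the `X × X̂`-type / product-of-Weil-surfaces / uniformly weighted
`E_Kⁿ × E_Kⁿ` members). This file states the answer ONCE, in the kernel, for every cell: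

* `exists_hyperbolic_member_iff_eq_split` — **the cell `(n, d, δ)` (`n ≥ 2`, `d ≥ 1`) contains a hyperbolic member
  iff `δ = splitDiscriminantClass n d = [(-1)ⁿ]`.** (⟹: a hyperbolic member has `det H = [(-1)ⁿ]`,
  `VanGeemen1994.hasWeilDiscriminantNondeg_neg_one_pow_of_isHyperbolicWeilType`, and `det H` of `h_K` is
  well defined, `VanGeemen1994.hasWeilDiscriminantNondeg_ksymm_unique` — van Geemen Lemma 5.2 (3); ⟸: the hyperbolic
  tower `HodgeTheory.exists_isHyperbolicWeilType_with_weilClass` inhabits the split cell.)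
* `not_isHyperbolicWeilType_of_ne_split` — on a NON-split cell NO member is hyperbolic for its class (`n ≥ 1`).
* `exists_hyperbolic_member_iff_mem_norm_of_odd` / `…_of_even` — the same with the arithmetic of
  `Ring2WeilCoverageNormCriteria`: for `δ = [-a]` (`n` odd) resp. `δ = [a]` (`n` even) a hyperbolic member exists
  iff `a ∈ Nm(K_dˣ)` (van Geemen (5.4.1): "`det H = (-1)ⁿ a` … `H` is hyperbolic iff `a ∈ Nm(K^*)`").

Complement (not restated): EVERY right-sign cell, split or not, contains the decomposable CM member
`(E_Kⁿ, k) × (E_Kⁿ, k̄)` with weights `(1ⁿ; 1ⁿ⁻¹, a)` — `Ring2.AbelianAll.exists_member` /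
`weilClassesComponent_inhabited_iff_sign` (`Ring2AbelianAllWeilCellsInhabited`). Sorry-free; axioms standard; no
`def`, no named fact.

## References

* [vanGeemen1994HodgeAV] B. van Geemen, LNM 1594 (1994), Lemma 5.2 (2)–(4), 5.4–5.5 and (5.4.1).
* [Landherr1936HermitianForms] W. Landherr, Abh. Math. Sem. Hamburg 11 (1936).
* [Markman2025SurveySecant] E. Markman, arXiv:2509.23403 (preprint), §11.5 Steps 1–2.
-/

noncomputable section

set_option linter.dupNamespace false

open CategoryTheory
open Literature.AlgebraicGeometry Literature.AlgebraicGeometry.Motives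
open Literature.AlgebraicGeometry.HodgeTheory
open Literature.AlgebraicGeometry.VanGeemen1994
open Literature.AlgebraicTopology.SingularHomology
open Summit.HodgeConjecture.HodgeConjecture.Ring2.Hypotheses

namespace Summit.HodgeConjecture.HodgeConjecture.Ring2.WeilCoverage

/-- **THE RULE of the split-special-fibre column.** For `n ≥ 2`, `d ≥ 1` and `δ ∈ ℚˣ/Nm(K_dˣ)`: the cell `(n, d, δ)`
contains a member `(A, φ, h_K)` — `dim A = 2n`, `φ ≫ φ = -d`, `h_K = d·e^*a + φ^*e^*a` (`a ≠ 0` rational) with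
NON-DEGENERATE `det H = δ` — that is HYPERBOLIC for `h_K`, iff `δ` is the split class `[(-1)ⁿ]`.
research route conditional on HC_CM; not a corollary; Q11.4-sentence-2 already refuted in dim ≥ 3.
[cite: vanGeemen1994HodgeAV, Lemma 5.2 (3), 5.4–5.5 and (5.4.1)] [cite: Markman2025SurveySecant, §11.5 Steps 1–2] -/
theorem exists_hyperbolic_member_iff_eq_split {n d : ℕ} (hn : 2 ≤ n) (hd : 0 < d) (δ : weilNormResidueGroup d) :
    (∃ (A : AbelianVariety ℂ) (φ : A ⟶ A) (e : ProjectiveEmbedding A.X) (a : complexBetti (projectiveSpace e.n ℂ) 2),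
        A.dim = 2 * n ∧ φ ≫ φ = -(d • 𝟙 A) ∧ IsRationalClass a ∧ a ≠ 0 ∧
          HasWeilDiscriminantNondeg A φ n d
            ((d : ℂ) • complexBetti.map e.ι 2 a + complexBetti.map φ.hom.hom.hom 2 (complexBetti.map e.ι 2 a)) δ ∧
          IsHyperbolicWeilType A φ n
            ((d : ℂ) • complexBetti.map e.ι 2 a + complexBetti.map φ.hom.hom.hom 2 (complexBetti.map e.ι 2 a))) ↔
      δ = splitDiscriminantClass n d := by
  constructor
  · rintro ⟨A, φ, e, a, hA, hφ, ha, ha0, hδ, hhyp⟩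
    exact hasWeilDiscriminantNondeg_ksymm_unique (by omega) hA hd hφ e ha hδ
      (hasWeilDiscriminantNondeg_neg_one_pow_of_isHyperbolicWeilType (by omega) hA hd hφ e ha ha0 hhyp)
  · rintro rfl
    obtain ⟨P, ψ₀, e, a, -, hP, hψ₀, ha, ha0, hhyp, -⟩ := exists_isHyperbolicWeilType_with_weilClass n d hn hd
    exact ⟨P, ψ₀, e, a, hP, hψ₀, ha, ha0,
      hasWeilDiscriminantNondeg_neg_one_pow_of_isHyperbolicWeilType (by omega) hP hd hψ₀ e ha ha0 hhyp, hhyp⟩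

/-- **On a NON-split cell no member is hyperbolic for its class** (`n ≥ 1`, `d ≥ 1`): if `h_K` has a non-degenerate
discriminant witness of class `δ ≠ [(-1)ⁿ]`, then `(A, φ)` is not hyperbolic for `h_K` (a hyperbolic `h_K` would have
`det H = [(-1)ⁿ]`, and the class of `h_K` is unique). This is the «NO — why» of the column.
research route conditional on HC_CM; not a corollary; Q11.4-sentence-2 already refuted in dim ≥ 3.
[cite: vanGeemen1994HodgeAV, Lemma 5.2 (3) and (5.4.1)] -/
theorem not_isHyperbolicWeilType_of_ne_split {n d : ℕ} (hn : 0 < n) (hd : 0 < d) {A : AbelianVariety ℂ} {φ : A ⟶ A}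
    (hA : A.dim = 2 * n) (hφ : φ ≫ φ = -(d • 𝟙 A)) (e : ProjectiveEmbedding A.X)
    {a : complexBetti (projectiveSpace e.n ℂ) 2} (ha : IsRationalClass a) (ha0 : a ≠ 0) {δ : weilNormResidueGroup d}
    (hδ : HasWeilDiscriminantNondeg A φ n d
      ((d : ℂ) • complexBetti.map e.ι 2 a + complexBetti.map φ.hom.hom.hom 2 (complexBetti.map e.ι 2 a)) δ)
    (hne : δ ≠ splitDiscriminantClass n d) :
    ¬ IsHyperbolicWeilType A φ n
        ((d : ℂ) • complexBetti.map e.ι 2 a + complexBetti.map φ.hom.hom.hom 2 (complexBetti.map e.ι 2 a)) :=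
  fun hhyp ↦ hne (hasWeilDiscriminantNondeg_ksymm_unique hn hA hd hφ e ha hδ
    (hasWeilDiscriminantNondeg_neg_one_pow_of_isHyperbolicWeilType hn hA hd hφ e ha ha0 hhyp))

/-- **Conversely a hyperbolic member pins the cell**: if `(A, φ)` is hyperbolic for `h_K` and `h_K` has a
non-degenerate discriminant witness of class `δ`, then `δ = [(-1)ⁿ]` (`n ≥ 1`).
research route conditional on HC_CM; not a corollary; Q11.4-sentence-2 already refuted in dim ≥ 3.
[cite: vanGeemen1994HodgeAV, Lemma 5.2 (3) and (5.4.1)] -/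
theorem eq_split_of_isHyperbolicWeilType {n d : ℕ} (hn : 0 < n) (hd : 0 < d) {A : AbelianVariety ℂ} {φ : A ⟶ A}
    (hA : A.dim = 2 * n) (hφ : φ ≫ φ = -(d • 𝟙 A)) (e : ProjectiveEmbedding A.X)
    {a : complexBetti (projectiveSpace e.n ℂ) 2} (ha : IsRationalClass a) (ha0 : a ≠ 0) {δ : weilNormResidueGroup d}
    (hδ : HasWeilDiscriminantNondeg A φ n d
      ((d : ℂ) • complexBetti.map e.ι 2 a + complexBetti.map φ.hom.hom.hom 2 (complexBetti.map e.ι 2 a)) δ)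
    (hhyp : IsHyperbolicWeilType A φ n
      ((d : ℂ) • complexBetti.map e.ι 2 a + complexBetti.map φ.hom.hom.hom 2 (complexBetti.map e.ι 2 a))) :
    δ = splitDiscriminantClass n d :=
  hasWeilDiscriminantNondeg_ksymm_unique hn hA hd hφ e ha hδ
    (hasWeilDiscriminantNondeg_neg_one_pow_of_isHyperbolicWeilType hn hA hd hφ e ha ha0 hhyp)

/-- **The rule in the census letter `a` for ODD `n`** (`g = 2n ∈ {6, 10, …}`, `δ = det H = -a`, `a > 0`): the cell
`(n, d, [-a])` contains a hyperbolic member iff `a ∈ Nm(K_dˣ)` — van Geemen (5.4.1) "`H` is hyperbolic iff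
`a ∈ Nm(K^*)`", at cell level. research route conditional on HC_CM; not a corollary; Q11.4-sentence-2 already refuted in dim ≥ 3.
[cite: vanGeemen1994HodgeAV, 5.4 and (5.4.1)] -/
theorem exists_hyperbolic_member_iff_mem_norm_of_odd {n d : ℕ} (hn : 2 ≤ n) (hodd : Odd n) (hd : 0 < d)
    {q : ℚ} (hq : q ≠ 0) :
    (∃ (A : AbelianVariety ℂ) (φ : A ⟶ A) (e : ProjectiveEmbedding A.X) (a : complexBetti (projectiveSpace e.n ℂ) 2),
        A.dim = 2 * n ∧ φ ≫ φ = -(d • 𝟙 A) ∧ IsRationalClass a ∧ a ≠ 0 ∧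
          HasWeilDiscriminantNondeg A φ n d
            ((d : ℂ) • complexBetti.map e.ι 2 a + complexBetti.map φ.hom.hom.hom 2 (complexBetti.map e.ι 2 a))
            (QuotientGroup.mk (-Units.mk0 q hq)) ∧
          IsHyperbolicWeilType A φ n
            ((d : ℂ) • complexBetti.map e.ι 2 a + complexBetti.map φ.hom.hom.hom 2 (complexBetti.map e.ι 2 a))) ↔
      Units.mk0 q hq ∈ normUnitsSubgroup ℚ (weilField d) := by
  rw [exists_hyperbolic_member_iff_eq_split hn hd, mk_neg_eq_splitDiscriminantClass_iff_of_odd hodd]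

/-- **The rule in the census letter `a` for EVEN `n`** (`g = 2n ∈ {4, 8, …}`, `δ = det H = a > 0`): the cell
`(n, d, [a])` contains a hyperbolic member iff `a ∈ Nm(K_dˣ)`.
research route conditional on HC_CM; not a corollary; Q11.4-sentence-2 already refuted in dim ≥ 3.
[cite: vanGeemen1994HodgeAV, 5.4 and (5.4.1)] -/
theorem exists_hyperbolic_member_iff_mem_norm_of_even {n d : ℕ} (hn : 2 ≤ n) (heven : Even n) (hd : 0 < d)
    {q : ℚ} (hq : q ≠ 0) :
    (∃ (A : AbelianVariety ℂ) (φ : A ⟶ A) (e : ProjectiveEmbedding A.X) (a : complexBetti (projectiveSpace e.n ℂ) 2),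
        A.dim = 2 * n ∧ φ ≫ φ = -(d • 𝟙 A) ∧ IsRationalClass a ∧ a ≠ 0 ∧
          HasWeilDiscriminantNondeg A φ n d
            ((d : ℂ) • complexBetti.map e.ι 2 a + complexBetti.map φ.hom.hom.hom 2 (complexBetti.map e.ι 2 a))
            (QuotientGroup.mk (Units.mk0 q hq)) ∧
          IsHyperbolicWeilType A φ n
            ((d : ℂ) • complexBetti.map e.ι 2 a + complexBetti.map φ.hom.hom.hom 2 (complexBetti.map e.ι 2 a))) ↔
      Units.mk0 q hq ∈ normUnitsSubgroup ℚ (weilField d) := by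
  rw [exists_hyperbolic_member_iff_eq_split hn hd, mk_eq_splitDiscriminantClass_iff_of_even heven]

end Summit.HodgeConjecture.HodgeConjecture.Ring2.WeilCoverage

end
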